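import Summits.QuantumFields.YangMills.Theorems.BalabanUVNodesPortHDecayOfRows

/-!
# PORT PT-H (slot 8) — THE SIGNED TEXT `BalabanUVNodes.PortPiDecayUniformH` PROVED: the generic Π-DECAY port text (T-3′, CRIT-1 RULING Q-8 2026-08-31T00:29Z,
# bytes `nodeO-cover/TYPER-SigT3p-v1.txt` sha16 `9e27aaca2379dab6`, director-ym №473 SLOT 8 GO) — (5.10) DECAY OF THE (1.21) LIMIT KERNEL AT ONE REAL HISTORY

Cell `ym-nodeO-ideate` ∕ `ym-balaban-port`, porter seat `ymgap-nodeO-port-PTC-1` (gen 2), slot-8 CLOSER (port-lead KEY WORD 00:35:07Z, director-ym №473 (c)).  The type of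
`portPiDecayUniformH` is the signed string VERBATIM (the route file `Theses/BalabanUVNodes.lean` renders `def PortPiDecayUniformH` and its `_holds` link from this
theorem; as for PT-D 27929 ∕ PT-C 27932 the closer states the text in full and does not import the route file).  [I] = [Balaban1987RG1], [15] = [Balaban1985Variational].

THE TEXT (Q-8: record-facing Π-currency = real-coupling DECAY, print's fixed-scheme road (4.37) + (1.18) + (4.4) + minimiser decay; the holomorphic T-3 is print's unexecuted
«(or analytic)» alternative p.266 and never a slot): for absolute letters `E₀ κ C₉ δ₀ Mg c₁ K₀ K₁` there is ONE `C ≥ 0` such that for every family ∕ representation ∕ colour basis ∕ step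
`k` ∕ history `v` ∕ catalogue ∕ spaces ∕ chart ∕ domain ∕ gauge action ∕ rotations ∕ response data ∕ volume sequence ∕ embedding: the (1.19)-mould `FormatPlusG` for the functional
`ΦfOf F fam ρ k v (K n)` (27930⁸'s consequent shape) → `Chart44D` ((4.4), 27932's shape) → chart equivariance ∧ «G semisimple» ∧ (A3) cut-locality → `Response9D` ([15] Prop. 9 in
gauge currency, 27931⁷′'s shape) → geometry ∕ cube-sum ∕ tree leaves + window isometry → response link (A2) → colour-scalar (1.20) → (1.21) `Limit121` →
`B12Sec2to5.Decay510 (plimOf F fam ρ bV k v 0 1) C (B12Decay510.delta1 δ₀ κ Mg)` — (5.10) p.293 with `δ₁ = ½ min{δ₀, κ∕M}`.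

THE PROOF = packaging of ★★ `PortH.decay510_plimOf_of_rows` (`BalabanUVNodesPortHDecayOfRows`): per volume (4.14) from (1.19) + the Ward rows
(`BalabanUVNodesPortS1.ward414_of_gaugeInv119_chart44D`), (4.37) at the real history (`B12Eq435SecondVariation`, (4.6) at n = 2 with (4.14), + RowL + RowS + the (1.7) cut),
the bidisc Cauchy estimate and the polymer sum in GAUGE currency (`B12Decay510Gauge.abs_twoPoint_le_of_gauge`, `hh` = (R1ᴰ) with `B_h := C₉`), window isometry at
`(μ, ν) = (1, 0)` and `B12Decay510.decay510_of_tendsto` along (1.21).  Witness `C := 16·E₀·C₉²·exp(δ₁·Mg·c₁)·K₀·max K₁ 0` (the letters `K₁, c₁` are unsigned in the text;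
`max K₁ 0` keeps `0 ≤ C` — print's O(1) either way).

HONEST FRAMING.  A FREE GENERIC IMPLICATION: every row is a HYPOTHESIS (the consequents of the OPEN port texts 27930⁸ ∕ 27932 ∕ 27931⁷′, the elementary leaves, the response
link, the colour-scalar identity, the (1.21) limit) — «kernel-closed +1» of rows ⟹ (5.10) decay at one real history, NOT a discharge of print; the record corollary
(`fam := recordTermsAx`, rows fed at the record) is lens-1's `RecordPlimDecayOnRuns[Ax]` shape and is NOT this file; nothing of Bałaban's estimates is asserted, ported or
discharged; K0⁷∕K0ᴬ NOT closed; NODE O 0∕1; COUNT 8∕28 · K 1∕4 UNMOVED unless the gate says otherwise; finite `𝕋⁴_{L^K}` at fixed ε — NOT continuum ∕ ℝ⁴ ∕ OS; **the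
Yang–Mills mass gap (Clay) is NOT proved by any of this.**  No `def`, `instance`, `notation`, `sorry`; axioms `{propext, Classical.choice, Quot.sound}`.
-/

noncomputable section

namespace Summit.QuantumFields.YangMills.Theorems.PortH

open Literature.MathematicalPhysics.QuantumFieldTheory.Balaban1983to89.B12Decay510 (delta1)

/-- ★★ **THE SIGNED PT-H TEXT `PortPiDecayUniformH` (T-3′, `TYPER-SigT3p-v1.txt` sha16 `9e27aaca2379dab6`), PROVED** — rows ⟹ (5.10) decay of the (1.21) limit kernel's
`(0,1)`-component at one real history, with ONE constant for all data (packaging of `decay510_plimOf_of_rows`; witness `C = 16E₀C₉²e^{δ₁Mg c₁}K₀·max K₁ 0`).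
[cite: Balaban1987RG1, (5.10) p.293, (4.35)–(4.37) pp.290–291, (1.18)–(1.21) pp.263–264, (4.4)–(4.5) pp.281–282, (4.14) p.284; Balaban1985Variational, Prop. 9 p.309] -/
theorem portPiDecayUniformH :
    ∀ (E₀ κ C₉ δ₀ Mg c₁ K₀ K₁ : ℝ), 0 ≤ E₀ → 0 < κ → 0 < δ₀ → 0 < Mg → 0 ≤ K₀ → ∃ C : ℝ, 0 ≤ C ∧ ∀ (F : Literature.MathematicalPhysics.QuantumFieldTheory.Balaban1983to89.T4Continuum.T4Family) (𝔄 : Type) [NormedRing 𝔄] [NormedAlgebra ℝ 𝔄] (V : Type) [NormedAddCommGroup V] [NormedSpace ℝ V] (ι : Type) [Fintype ι] [DecidableEq ι] (fam : Literature.MathematicalPhysics.QuantumFieldTheory.Balaban1983to89.Node00.TermFamily1 F 𝔄) (ρ : V →L[ℝ] 𝔄) (bV : Module.Basis ι ℝ V) (aStar : ι) (k : ℕ) (v : Fin (k + 1) → ℝ) (S : ℕ → Literature.MathematicalPhysics.QuantumFieldTheory.Balaban1983to89.LocDomainSys) (M m : ℕ → ℕ) (Uc : (n : ℕ) → (S n).Dom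 → Set (Fin (M n) → ℂ)) (coords : (n : ℕ) → (S n).Dom → Finset (Fin (M n))) (χ : (n : ℕ) → (S n).Dom → (Fin (m n) → ℂ) → (Fin (M n) → ℂ)) (D : (n : ℕ) → (S n).Dom → Set (Fin (m n) → ℂ)) (Gg : ℕ → Type) (act : (n : ℕ) → Gg n → (Fin (M n) → ℂ) → (Fin (M n) → ℂ)) (Hg : ℕ → Type) (toG : (n : ℕ) → Hg n → Gg n) (A : (n : ℕ) → Hg n → ((Fin (m n) → ℂ) →L[ℂ] (Fin (m n) → ℂ))) (R : Literature.MathematicalPhysics.QuantumFieldTheory.Balaban1983to89.B12FormatPlus.Response9Data S M m 4) (Nw : ℕ → ℕ) (K : ℕ → ℕ) (ιe : (n : ℕ) → (Fin (F.P (K n)).d → Literature.MathematicalPhysics.QuantumFieldTheory.Balaban1983to89.Site (F.P (K n)) (k + 1) → V) → (Fin (m n) → ℂ)), Literature.MathematicalPhysics.QuantumFieldTheory.Balaban1983to89.B12FormatPlus.FormatPlusG S M act Uc coords m χ (fun n => Summit.QuantumFields.YangMills.Theorems.K0RecordFormatNames.ΦfOf F fam ρ k v (K n)) ιe R.wrap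 R.emb R.πc E₀ κ → Literature.MathematicalPhysics.QuantumFieldTheory.Balaban1983to89.B12FormatPlus.Chart44D S M Uc m χ D → (Literature.MathematicalPhysics.QuantumFieldTheory.Balaban1983to89.B12FormatPlus.ChartEquivariant toG act χ A ∧ (∀ n, Literature.MathematicalPhysics.QuantumFieldTheory.Balaban1983to89.B12FormatPlus.NoInvariantCovector (A n)) ∧ ∀ n X u, ∀ i ∈ coords n X, χ n X (Literature.MathematicalPhysics.QuantumFieldTheory.Balaban1983to89.B12FormatPlus.cutTo (R.cX n X) u) i = χ n X u i) → Literature.MathematicalPhysics.QuantumFieldTheory.Balaban1983to89.B12FormatPlus.Response9D R χ Nw D C₉ δ₀ → ((∀ n, Literature.MathematicalPhysics.QuantumFieldTheory.Balaban1983to89.B12Decay510.GeomLeaf (R.G n) (R.ρ n) Mg c₁ ∧ Literature.MathematicalPhysics.QuantumFieldTheory.Balaban1983to89.B12Decay510.CubeSumLeaf (R.G n) (δ₀ / 2) K₁ ∧ Literature.MathematicalPhysics.QuantumFieldTheory.Balaban1983to89.B12Decay510.TreeLeaf (R.Cc n) (κ / 2) K₀) ∧ ∀ (μ ν : Fin 4)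 (z : Fin 4 → ℤ), ∀ᶠ n in Filter.atTop, R.ρ n (R.e n μ 0) (R.e n ν z) = Literature.MathematicalPhysics.QuantumFieldTheory.Balaban1983to89.B12Sec2to5.l1 z) → (∀ n, ιe n 0 = 0 ∧ ContDiffAt ℝ 2 (ιe n) 0 ∧ ∀ (μ : Fin 4) (z : Fin 4 → ℤ), R.Gk n (R.e n μ z) = fderiv ℝ (ιe n) 0 (Pi.single (Fin.cast (F.P_d (K n)).symm μ) (Pi.single (Literature.MathematicalPhysics.QuantumFieldTheory.Balaban1983to89.Node00.siteOfInt F (K n) (k + 1) z) (bV aStar)))) → (∀ (n : ℕ) (z : Fin 4 → ℤ), Summit.QuantumFields.YangMills.Theorems.K0RecordFormatNames.pvolOf F fam ρ bV k v (K n) 0 1 z = Literature.MathematicalPhysics.QuantumFieldTheory.Balaban1983to89.B12PolarizationTensor120.polComp ℝ (Literature.MathematicalPhysics.QuantumFieldTheory.Balaban1983to89.B12PolarizationTensor120.expChart (fam k v (K n)) ρ) bV (Fin.cast (F.P_d (K n)).symm 0) (Literature.MathematicalPhysics.QuantumFieldTheory.Balaban1983to89.Node00.siteOfInt F (K n) (k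 + 1) z) aStar (Fin.cast (F.P_d (K n)).symm 1) (Literature.MathematicalPhysics.QuantumFieldTheory.Balaban1983to89.Node00.siteOfInt F (K n) (k + 1) 0) aStar) → Literature.MathematicalPhysics.QuantumFieldTheory.Balaban1983to89.B12FormatPlus.Limit121 (fun n => Summit.QuantumFields.YangMills.Theorems.K0RecordFormatNames.pvolOf F fam ρ bV k v (K n)) (Summit.QuantumFields.YangMills.Theorems.K0RecordFormatNames.plimOf F fam ρ bV k v) → Literature.MathematicalPhysics.QuantumFieldTheory.Balaban1983to89.B12Sec2to5.Decay510 (Summit.QuantumFields.YangMills.Theorems.K0RecordFormatNames.plimOf F fam ρ bV k v 0 1) C (Literature.MathematicalPhysics.QuantumFieldTheory.Balaban1983to89.B12Decay510.delta1 δ₀ κ Mg) := by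
  intro E₀ κ C₉ δ₀ Mg c₁ K₀ K₁ hE₀ hκ hδ₀ hMg hK₀
  have hCK : 0 ≤ 16 * E₀ * C₉ ^ 2 * Real.exp (delta1 δ₀ κ Mg * Mg * c₁) * K₀ :=
    mul_nonneg (mul_nonneg (mul_nonneg (mul_nonneg (by norm_num) hE₀) (sq_nonneg _)) (Real.exp_pos _).le) hK₀
  refine ⟨16 * E₀ * C₉ ^ 2 * Real.exp (delta1 δ₀ κ Mg * Mg * c₁) * K₀ * max K₁ 0, mul_nonneg hCK (le_max_right _ _), ?_⟩
  intro F 𝔄 _ _ V _ _ ι _ _ fam ρ bV aStar k v S M m Uc coords χ D Gg act Hg toG A R Nw K ιe hA hC hRowC hR hRowG hL hS hLim z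
  have h := decay510_plimOf_of_rows F fam ρ bV aStar k v Uc coords χ D act toG A R Nw K ιe hE₀ hκ.le hδ₀.le hMg hK₀ hA hC
    hRowC.1 hRowC.2.1 hRowC.2.2 hR (fun n => (hRowG.1 n).1) (fun n => (hRowG.1 n).2.1) (fun n => (hRowG.1 n).2.2) hRowG.2 hL hS hLim z
  exact h.trans (mul_le_mul_of_nonneg_right (mul_le_mul_of_nonneg_left (le_max_left _ _) hCK) (Real.exp_pos _).le)

end Summit.QuantumFields.YangMills.Theorems.PortH

end
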